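import Mathlib
import Literature.Probability.LatticeModels.ScalingLimitCompactness
import Literature.Probability.LatticeModels.BoxDirichlet
import Literature.Probability.LatticeModels.DomainDiscretisation
import HarnessLib

/-!
# Subsequential scaling limits of locally bounded lattice-harmonic functions

Topic `Literature/Probability/LatticeModels` (discrete potential theory on `δℤ²` → continuum). The
compactness step "uniformly bounded discrete harmonic functions have a subsequence converging
uniformly on compact subsets to a continuous function" (D. Chelkak, S. Smirnov, Adv. Math. 228
(2011), Prop. 3.1 and the proof of Thm. 3.13: "`H^{δ_k} ⇉ H` on compact subsets"; harmonicity of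
the limit is `DiscreteHarmonicLimit.lean`), assembled from the tree's interior gradient estimate
(`BoxDirichlet.harmonic_box_gradient_le`: `|∇h| ≲ M/N` in the middle of a box of side `N` on whose
sides `|h| ≤ M`) and the extraction theorem for asymptotically equicontinuous families of step
functions (`ScalingLimitCompactness.exists_subseq_tendstoUniformlyOn_of_asympEquicontinuous`).

* `abs_sub_le_of_forall_abs_step_le` (1-D) and `abs_sub_le_of_gradient` (2-D): a lattice
  function with steps `≤ g` on a sup-norm box varies by `≤ g · ℓ¹`-distance;
* **`exists_subseq_tendstoUniformlyOn_of_latticeHarmonic`** — for `δ_n → 0⁺`, lattice functions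
  `P n`, lattice-harmonic at every site whose closed mesh `δ_n`-disc lies in the open set `D`, and
  bounded on (the sites with mesh point in) each compact subset of `D` eventually-uniformly in `n`,
  there are a subsequence `φ` and `H` continuous on `D` with
  `z ↦ P (φ n) (nearestSite (δ (φ n)) z) → H` uniformly on every compact `K ⊆ D`.

Everything is proved, [folklore].
-/

noncomputable section

namespace Literature.Probability.LatticeModels

open _root_.Complex Metric Set Filter
open scoped Topology

/-! ### Lattice functions with small steps vary little -/

/-- **1-D**: if `|f (i+1) - f i| ≤ g` whenever `i` and `i + 1` are within `R` of `c`, then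
`|f i - f c| ≤ g |i - c|` for `|i - c| ≤ R`. [folklore] -/
theorem abs_sub_le_of_forall_abs_step_le {f : ℤ → ℝ} {g : ℝ} {c : ℤ} {R : ℤ}
    (hstep : ∀ i : ℤ, |i - c| ≤ R → |i + 1 - c| ≤ R → |f (i + 1) - f i| ≤ g)
    {i : ℤ} (hi : |i - c| ≤ R) : |f i - f c| ≤ g * |((i - c : ℤ) : ℝ)| := by
  -- induction on the distance
  have key : ∀ n : ℕ, ∀ i : ℤ, (i - c = n ∨ c - i = n) → |i - c| ≤ R → |f i - f c| ≤ g * n := by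
    intro n
    induction n with
    | zero =>
      intro i hi _
      have : i = c := by omega
      simp [this]
    | succ n ih =>
      intro i hi hiR
      rcases hi with hi | hi
      · -- `i = c + n + 1`: step at `i - 1`
        have h1 : |i - 1 - c| ≤ R := by rw [abs_le] at hiR ⊢; omega
        have h2 := ih (i - 1) (by omega) h1
        have h3 := hstep (i - 1) h1 (by rw [sub_add_cancel]; exact hiR)
        rw [sub_add_cancel] at h3
        calc |f i - f c| = |(f i - f (i - 1)) + (f (i - 1) - f c)| := by ring_nf
          _ ≤ |f i - f (i - 1)| + |f (i - 1) - f c| := abs_add_le _ _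
          _ ≤ g + g * n := add_le_add h3 h2
          _ = g * (n + 1 : ℕ) := by push_cast; ring
      · -- `i = c - n - 1`: step at `i`
        have h1 : |i + 1 - c| ≤ R := by rw [abs_le] at hiR ⊢; omega
        have h2 := ih (i + 1) (by omega) h1
        have h3 := hstep i hiR h1
        calc |f i - f c| = |(f (i + 1) - f c) - (f (i + 1) - f i)| := by ring_nf
          _ ≤ |f (i + 1) - f c| + |f (i + 1) - f i| := abs_sub _ _
          _ ≤ g * n + g := add_le_add h2 h3
          _ = g * (n + 1 : ℕ) := by push_cast; ring
  have hn : i - c = ((i - c).natAbs : ℕ) ∨ c - i = ((i - c).natAbs : ℕ) := by omega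
  have := key _ i hn hi
  rwa [Nat.cast_natAbs, Int.cast_abs] at this

/-- Sites in coordinates. [folklore] -/
private theorem site_eta (v : Site 2) : v = ![v 0, v 1] := by ext i; fin_cases i <;> rfl

/-- `![i, j] + e₀ = ![i + 1, j]`. [folklore] -/
private theorem vec_add_cornerUnit_zero (i j : ℤ) : (![i, j] : Site 2) + cornerUnit 0 = ![i + 1, j] := by
  ext l; fin_cases l <;> simp [cornerUnit]

/-- `![i, j] + e₁ = ![i, j + 1]`. [folklore] -/
private theorem vec_add_cornerUnit_one (i j : ℤ) : (![i, j] : Site 2) + cornerUnit 1 = ![i, j + 1] := by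
  ext l; fin_cases l <;> simp [cornerUnit]

/-- **2-D**: if all lattice steps of `h` on the sup-norm box of radius `R` about `v` are `≤ g`,
then `|h v' - h v| ≤ g (|v'₀ - v₀| + |v'₁ - v₁|)` for `v'` in that box (path along the axes). [folklore] -/
theorem abs_sub_le_of_gradient {h : Site 2 → ℝ} {g : ℝ} {v : Site 2} {R : ℤ}
    (hstep : ∀ x : Site 2, |x 0 - v 0| ≤ R → |x 1 - v 1| ≤ R → ∀ k : Fin 4, |h (x + cornerUnit k) - h x| ≤ g)
    {v' : Site 2} (h0 : |v' 0 - v 0| ≤ R) (h1 : |v' 1 - v 1| ≤ R) :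
    |h v' - h v| ≤ g * (|((v' 0 - v 0 : ℤ) : ℝ)| + |((v' 1 - v 1 : ℤ) : ℝ)|) := by
  have hR : 0 ≤ R := (abs_nonneg _).trans h0
  -- horizontal leg
  have hhor : |h ![v' 0, v 1] - h v| ≤ g * |((v' 0 - v 0 : ℤ) : ℝ)| := by
    have := abs_sub_le_of_forall_abs_step_le (f := fun i => h ![i, v 1]) (c := v 0) (R := R)
      (fun i hi hi' => by
        have := hstep ![i, v 1] (by simpa using hi) (by simp [hR]) 0
        rwa [vec_add_cornerUnit_zero] at this) h0
    simpa [← site_eta v] using this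
  -- vertical leg
  have hver : |h v' - h ![v' 0, v 1]| ≤ g * |((v' 1 - v 1 : ℤ) : ℝ)| := by
    have := abs_sub_le_of_forall_abs_step_le (f := fun j => h ![v' 0, j]) (c := v 1) (R := R)
      (fun j hj hj' => by
        have := hstep ![v' 0, j] (by simpa using h0) (by simpa using hj) 1
        rwa [vec_add_cornerUnit_one] at this) h1
    simpa [← site_eta v'] using this
  calc |h v' - h v| = |(h v' - h ![v' 0, v 1]) + (h ![v' 0, v 1] - h v)| := by ring_nf
    _ ≤ |h v' - h ![v' 0, v 1]| + |h ![v' 0, v 1] - h v| := abs_add_le _ _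
    _ ≤ g * |((v' 1 - v 1 : ℤ) : ℝ)| + g * |((v' 0 - v 0 : ℤ) : ℝ)| := add_le_add hver hhor
    _ = g * (|((v' 0 - v 0 : ℤ) : ℝ)| + |((v' 1 - v 1 : ℤ) : ℝ)|) := by ring

/-! ### Distances of mesh points -/

/-- Sup-distance of two sites from the distance of their mesh points. [folklore] -/
private theorem abs_sub_le_of_norm_meshPoint_le {δ : ℝ} (hδ : 0 < δ) {v v' : Site 2} {R : ℝ}
    (h : ‖meshPoint δ v - meshPoint δ v'‖ ≤ δ * R) :
    |((v 0 - v' 0 : ℤ) : ℝ)| ≤ R ∧ |((v 1 - v' 1 : ℤ) : ℝ)| ≤ R := by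
  have hre := (abs_re_le_norm _).trans h
  have him := (abs_im_le_norm _).trans h
  rw [sub_re, meshPoint_re, meshPoint_re, ← mul_sub, abs_mul, abs_of_pos hδ] at hre
  rw [sub_im, meshPoint_im, meshPoint_im, ← mul_sub, abs_mul, abs_of_pos hδ] at him
  push_cast
  exact ⟨le_of_mul_le_mul_left hre hδ, le_of_mul_le_mul_left him hδ⟩

/-- Distance of mesh points from the `ℓ¹`-distance of sites. [folklore] -/
private theorem norm_meshPoint_sub_le' {δ : ℝ} (hδ : 0 ≤ δ) (v v' : Site 2) :
    ‖meshPoint δ v - meshPoint δ v'‖ ≤ δ * (|((v 0 - v' 0 : ℤ) : ℝ)| + |((v 1 - v' 1 : ℤ) : ℝ)|) := by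
  have h := norm_le_abs_re_add_abs_im (meshPoint δ v - meshPoint δ v')
  rw [sub_re, meshPoint_re, meshPoint_re, ← mul_sub, sub_im, meshPoint_im, meshPoint_im, ← mul_sub,
    abs_mul, abs_mul, abs_of_nonneg hδ] at h
  push_cast
  linarith

/-- Mesh points of a sup-norm box of radius `R` are within `2Rδ`. [folklore] -/
theorem dist_meshPoint_le_of_abs_le {δ : ℝ} (hδ : 0 ≤ δ) {v x : Site 2} {R : ℤ}
    (h0 : |x 0 - v 0| ≤ R) (h1 : |x 1 - v 1| ≤ R) : dist (meshPoint δ x) (meshPoint δ v) ≤ δ * (2 * R) := by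
  rw [dist_eq_norm]
  have h0' : |((x 0 - v 0 : ℤ) : ℝ)| ≤ R := by exact_mod_cast h0
  have h1' : |((x 1 - v 1 : ℤ) : ℝ)| ≤ R := by exact_mod_cast h1
  calc ‖meshPoint δ x - meshPoint δ v‖ ≤ δ * (|((x 0 - v 0 : ℤ) : ℝ)| + |((x 1 - v 1 : ℤ) : ℝ)|) :=
        norm_meshPoint_sub_le' hδ x v
    _ ≤ δ * (2 * R) := mul_le_mul_of_nonneg_left (by linarith) hδ

/-! ### The gradient bound near a point well inside the domain -/

/-- **Uniform gradient bound in the middle of an interior box.** Let `h` be lattice-harmonic at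
every site of the sup-box of radius `N` about `v` and `|h| ≤ M` there (`N ≥ 16`). Then the lattice
steps of `h` on the sup-box of radius `N/4 - 1` about `v` are `≤ 4 K M / N`. [folklore] -/
theorem abs_step_le_of_harmonic_box {h : Site 2 → ℝ} {v : Site 2} {N : ℕ} (hN : 16 ≤ N)
    (hharm : ∀ x : Site 2, |x 0 - v 0| ≤ N → |x 1 - v 1| ≤ N → latticeLaplacian h x = 0)
    {M : ℝ} (hM0 : 0 ≤ M) (hM : ∀ x : Site 2, |x 0 - v 0| ≤ N → |x 1 - v 1| ≤ N → |h x| ≤ M)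
    {x : Site 2} (hx0 : |x 0 - v 0| ≤ (N / 4 : ℕ) - 1) (hx1 : |x 1 - v 1| ≤ (N / 4 : ℕ) - 1) (k : Fin 4) :
    |h (x + cornerUnit k) - h x| ≤ 4 * topGradConst * M / N := by
  set a : Site 2 := ![v 0 - (N / 2 : ℕ), v 1 - (N / 2 : ℕ)] with ha
  have ha0 : a 0 = v 0 - (N / 2 : ℕ) := rfl
  have ha1 : a 1 = v 1 - (N / 2 : ℕ) := rfl
  have hN2 : 2 * ((N / 2 : ℕ) : ℤ) ≤ N ∧ (N : ℤ) ≤ 2 * ((N / 2 : ℕ) : ℤ) + 1 := by omega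
  have hN4 : 4 * ((N / 4 : ℕ) : ℤ) ≤ N ∧ (N : ℤ) ≤ 4 * ((N / 4 : ℕ) : ℤ) + 3 := by omega
  have hhI : IsLatticeHarmonicOn h (boxInterior a N) := by
    intro y hy
    simp only [boxInterior, mem_setOf_eq, ha0, ha1] at hy
    refine hharm y ?_ ?_ <;> rw [abs_le] <;> constructor <;> omega
  have hsides : ∀ i : ℕ, 0 < i → i < N →
      |h ![a 0 + i, a 1 + N]| ≤ M ∧ |h ![a 0 + i, a 1]| ≤ M ∧ |h ![a 0, a 1 + i]| ≤ M ∧ |h ![a 0 + N, a 1 + i]| ≤ M := by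
    intro i hi hiN
    have hi' : (i : ℤ) < N := by exact_mod_cast hiN
    refine ⟨hM _ ?_ ?_, hM _ ?_ ?_, hM _ ?_ ?_, hM _ ?_ ?_⟩ <;>
      simp only [Matrix.cons_val_zero, Matrix.cons_val_one, ha0, ha1, abs_le] <;>
      constructor <;> omega
  have hxm : x ∈ boxMiddle a N := by
    simp only [boxMiddle, mem_setOf_eq, ha0, ha1]
    rw [abs_le] at hx0 hx1
    refine ⟨?_, ?_, ?_, ?_⟩ <;> omega
  exact harmonic_box_gradient_le (a := a) (N := N) hN hhI hM0 hsides hxm k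

/-! ### The theorem -/

/-- **Subsequential local uniform limits of locally bounded lattice-harmonic functions.** Let `D`
be open, `δ n → 0⁺`, and `P n : ℤ² → ℝ` lattice-harmonic at every site whose closed mesh `δ n`-disc
lies in `D`; suppose that on each compact `K ⊆ D` the values at sites with mesh point in `K` are
bounded, eventually-uniformly in `n`. Then along a subsequence the step functions
`z ↦ P n (nearestSite (δ n) z)` converge uniformly on every compact subset of `D` to a function
continuous on `D`. (Chelkak–Smirnov 2011, Prop. 3.1 / proof of Thm. 3.13.) [folklore] -/
theorem exists_subseq_tendstoUniformlyOn_of_latticeHarmonic {D : Set ℂ} (hD : IsOpen D)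
    {δ : ℕ → ℝ} (hδ : ∀ n, 0 < δ n) (hδ0 : Tendsto δ atTop (𝓝 0)) (P : ℕ → Site 2 → ℝ)
    (hharm : ∀ n (v : Site 2), closedBall (meshPoint (δ n) v) (δ n) ⊆ D → latticeLaplacian (P n) v = 0)
    (hbdd : ∀ K ⊆ D, IsCompact K → ∃ M : ℝ, ∀ᶠ n in atTop, ∀ v : Site 2,
      meshPoint (δ n) v ∈ K → |P n v| ≤ M) :
    ∃ φ : ℕ → ℕ, StrictMono φ ∧ ∃ H : ℂ → ℝ, ContinuousOn H D ∧
      ∀ K ⊆ D, IsCompact K →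
        TendstoUniformlyOn (fun n z => P (φ n) (nearestSite (δ (φ n)) z)) H atTop K := by
  set u : ℕ → ℂ → ℂ := fun n z => ((P n (nearestSite (δ n) z) : ℝ) : ℂ) with hu
  -- a compact neighbourhood inside `D` of a compact `K ⊆ D`, with a bound there
  have hnbhd : ∀ K ⊆ D, IsCompact K → ∃ r > 0, cthickening r K ⊆ D ∧ IsCompact (cthickening r K) ∧
      ∃ M : ℝ, 0 ≤ M ∧ ∀ᶠ n in atTop, ∀ v : Site 2, meshPoint (δ n) v ∈ cthickening r K → |P n v| ≤ M := by
    intro K hKD hK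
    obtain ⟨r, hr, hrD⟩ := hK.exists_cthickening_subset_open hD hKD
    obtain ⟨M, hM⟩ := hbdd _ hrD (hK.cthickening)
    refine ⟨r, hr, hrD, hK.cthickening, max M 0, le_max_right _ _, ?_⟩
    filter_upwards [hM] with n hn v hv
    exact (hn v hv).trans (le_max_left _ _)
  -- uniform bounds
  have hbdd' : ∀ K ⊆ D, IsCompact K → ∃ M : ℝ, ∀ᶠ n in atTop, ∀ z ∈ K, ‖u n z‖ ≤ M := by
    intro K hKD hK
    obtain ⟨r, hr, -, -, M, -, hM⟩ := hnbhd K hKD hK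
    refine ⟨M, ?_⟩
    filter_upwards [hM, hδ0.eventually (gt_mem_nhds hr)] with n hn hnr z hz
    simp only [hu, norm_real, Real.norm_eq_abs]
    apply hn
    exact mem_cthickening_of_dist_le _ z _ _ hz ((dist_meshPoint_nearestSite_le (hδ n) z).trans hnr.le)
  -- asymptotic equicontinuity
  have hequi : ∀ K ⊆ D, IsCompact K → ∃ L : ℝ, 0 ≤ L ∧ ∀ᶠ n in atTop, ∀ z ∈ K, ∀ z' ∈ K,
      ‖u n z - u n z'‖ ≤ L * (‖z - z'‖ + 2 * δ n) := by
    intro K hKD hK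
    obtain ⟨r, hr, hrD, -, M, hM0, hM⟩ := hnbhd K hKD hK
    set ρ := r / 4 with hρ
    have hρ0 : 0 < ρ := by positivity
    set C := topGradConst with hC
    have hC0 : 0 < C := topGradConst_pos
    refine ⟨32 * (C + 1) * M / ρ, by positivity, ?_⟩
    filter_upwards [hM, hδ0.eventually (gt_mem_nhds (show 0 < ρ / 80 by positivity))] with n hn hnρ z hz z' hz'
    set d := δ n with hd
    have hd0 : 0 < d := hδ n
    -- the box scale
    set N := ⌊ρ / (2 * d)⌋₊ with hN
    have hNle : (N : ℝ) ≤ ρ / (2 * d) := Nat.floor_le (by positivity)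
    have hNge : ρ / (2 * d) - 1 ≤ N := by
      have := Nat.lt_floor_add_one (ρ / (2 * d)); linarith
    have hρd : 40 ≤ ρ / (2 * d) := by rw [le_div_iff₀ (by positivity)]; linarith
    have hN16 : 16 ≤ N := by
      have : (16 : ℝ) ≤ N := by linarith
      exact_mod_cast this
    have hNd : (N : ℝ) * d ≤ ρ / 2 := by
      have := (le_div_iff₀ (by positivity : (0 : ℝ) < 2 * d)).1 hNle
      linarith
    -- sites near `nearestSite z` are well inside `D`, where `|P n| ≤ M`
    set v := nearestSite d z with hv
    have hvz : dist (meshPoint d v) z ≤ d := dist_meshPoint_nearestSite_le hd0 z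
    have hnear : ∀ x : Site 2, |x 0 - v 0| ≤ N → |x 1 - v 1| ≤ N →
        closedBall (meshPoint d x) d ⊆ cthickening r K := by
      intro x hx0 hx1 p hp
      rw [mem_closedBall] at hp
      have hxv := dist_meshPoint_le_of_abs_le hd0.le hx0 hx1
      push_cast at hxv
      apply mem_cthickening_of_dist_le p z r K hz
      calc dist p z ≤ dist p (meshPoint d x) + dist (meshPoint d x) (meshPoint d v) + dist (meshPoint d v) z :=
            dist_triangle4 _ _ _ _
        _ ≤ d + d * (2 * N) + d := by linarith
        _ ≤ r := by nlinarith
    have hharm' : ∀ x : Site 2, |x 0 - v 0| ≤ N → |x 1 - v 1| ≤ N → latticeLaplacian (P n) x = 0 :=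
      fun x hx0 hx1 => hharm n x ((hnear x hx0 hx1).trans hrD)
    have hM' : ∀ x : Site 2, |x 0 - v 0| ≤ N → |x 1 - v 1| ≤ N → |P n x| ≤ M :=
      fun x hx0 hx1 => hn x (hnear x hx0 hx1 (mem_closedBall_self hd0.le))
    -- the gradient bound on the box of radius `N/4 - 1`
    have hgrad : ∀ x : Site 2, |x 0 - v 0| ≤ (N / 4 : ℕ) - 1 → |x 1 - v 1| ≤ (N / 4 : ℕ) - 1 →
        ∀ k : Fin 4, |P n (x + cornerUnit k) - P n x| ≤ 4 * C * M / N :=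
      fun x hx0 hx1 k => abs_step_le_of_harmonic_box hN16 hharm' hM0 hM' hx0 hx1 k
    have hg0 : 0 ≤ 4 * C * M / N := by positivity
    have hgle : 4 * C * M / N ≤ 16 * C * M * d / ρ := by
      have hNpos : (0 : ℝ) < N := by exact_mod_cast (show 0 < N by omega)
      rw [div_le_div_iff₀ hNpos hρ0]
      have : ρ ≤ 4 * N * d := by
        have h1 : ρ / (2 * d) - 1 ≤ N := hNge
        rw [div_sub_one (by positivity), div_le_iff₀ (by positivity)] at h1
        nlinarith
      nlinarith [mul_nonneg (mul_nonneg (by norm_num : (0:ℝ) ≤ 4) hC0.le) hM0]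
    -- the two cases: close or far
    by_cases hclose : ‖z - z'‖ ≤ ρ / 16
    · set v' := nearestSite d z' with hv'
      have hv'z' : dist (meshPoint d v') z' ≤ d := dist_meshPoint_nearestSite_le hd0 z'
      have hvv' : ‖meshPoint d v' - meshPoint d v‖ ≤ d * ((‖z - z'‖ + 2 * d) / d) := by
        rw [mul_div_cancel₀ _ hd0.ne', ← dist_eq_norm]
        calc dist (meshPoint d v') (meshPoint d v) ≤ dist (meshPoint d v') z' + dist z' z + dist z (meshPoint d v) :=
              dist_triangle4 _ _ _ _
          _ ≤ d + ‖z - z'‖ + d := by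
              have e1 : dist z' z = ‖z - z'‖ := by rw [dist_comm, dist_eq_norm]
              have e2 : dist z (meshPoint d v) ≤ d := by rw [dist_comm]; exact hvz
              linarith [hv'z']
          _ = ‖z - z'‖ + 2 * d := by ring
      obtain ⟨h0, h1⟩ := abs_sub_le_of_norm_meshPoint_le hd0 hvv'
      have hRle : (‖z - z'‖ + 2 * d) / d ≤ ((N / 4 : ℕ) : ℝ) - 1 := by
        have h4 : ((N : ℝ) - 3) / 4 ≤ ((N / 4 : ℕ) : ℝ) := by
          have : (N : ℤ) ≤ 4 * ((N / 4 : ℕ) : ℤ) + 3 := by omega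
          have : (N : ℝ) ≤ 4 * ((N / 4 : ℕ) : ℝ) + 3 := by exact_mod_cast this
          linarith
        rw [div_le_iff₀ hd0]
        have h5 : ρ / (2 * d) - 1 ≤ N := hNge
        rw [div_sub_one (by positivity), div_le_iff₀ (by positivity)] at h5
        have h6 : ((N : ℝ) - 3) / 4 * d ≤ ((N / 4 : ℕ) : ℝ) * d := mul_le_mul_of_nonneg_right h4 hd0.le
        linarith
      have h0' : |v' 0 - v 0| ≤ ((N / 4 : ℕ) : ℤ) - 1 := by
        have : (|((v' 0 - v 0 : ℤ) : ℝ)|) ≤ ((N / 4 : ℕ) : ℝ) - 1 := h0.trans hRle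
        exact_mod_cast this
      have h1' : |v' 1 - v 1| ≤ ((N / 4 : ℕ) : ℤ) - 1 := by
        have : (|((v' 1 - v 1 : ℤ) : ℝ)|) ≤ ((N / 4 : ℕ) : ℝ) - 1 := h1.trans hRle
        exact_mod_cast this
      have hkey := abs_sub_le_of_gradient hgrad h0' h1'
      simp only [hu, ← ofReal_sub, norm_real, Real.norm_eq_abs, ← hv, ← hv', ← hd]
      rw [abs_sub_comm]
      calc |P n v' - P n v| ≤ 4 * C * M / N * (|((v' 0 - v 0 : ℤ) : ℝ)| + |((v' 1 - v 1 : ℤ) : ℝ)|) := hkey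
        _ ≤ 16 * C * M * d / ρ * (2 * ((‖z - z'‖ + 2 * d) / d)) :=
            mul_le_mul hgle (by linarith) (by positivity) (by positivity)
        _ = 32 * C * M / ρ * (‖z - z'‖ + 2 * d) := by field_simp; ring
        _ ≤ 32 * (C + 1) * M / ρ * (‖z - z'‖ + 2 * d) := by
            apply mul_le_mul_of_nonneg_right _ (by positivity)
            apply div_le_div_of_nonneg_right _ hρ0.le
            nlinarith
    · push Not at hclose
      have hb : ∀ w ∈ K, ‖u n w‖ ≤ M := by
        intro w hw
        simp only [hu, norm_real, Real.norm_eq_abs]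
        apply hn
        apply mem_cthickening_of_dist_le _ w _ _ hw
        exact (dist_meshPoint_nearestSite_le hd0 w).trans (by linarith)
      calc ‖u n z - u n z'‖ ≤ ‖u n z‖ + ‖u n z'‖ := norm_sub_le _ _
        _ ≤ M + M := add_le_add (hb z hz) (hb z' hz')
        _ = 32 * M / ρ * (ρ / 16) := by field_simp; ring
        _ ≤ 32 * (C + 1) * M / ρ * (‖z - z'‖ + 2 * d) := by
            apply mul_le_mul _ (by linarith) (by positivity) (by positivity)
            apply div_le_div_of_nonneg_right _ hρ0.le
            nlinarith
  -- extraction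
  have hε : Tendsto (fun n => 2 * δ n) atTop (𝓝 0) := by simpa using hδ0.const_mul 2
  obtain ⟨φ, hφ, g, hgc, hg⟩ :=
    exists_subseq_tendstoUniformlyOn_of_asympEquicontinuous hD u (fun n => 2 * δ n) hε hbdd' hequi
  refine ⟨φ, hφ, fun z => (g z).re, continuous_re.comp_continuousOn hgc, fun K hKD hK => ?_⟩
  have h1 := Complex.reCLM.uniformContinuous.comp_tendstoUniformlyOn (hg K hKD hK)
  refine h1.congr (Eventually.of_forall fun n => ?_)
  intro z _
  simp [hu]

end Literature.Probability.LatticeModels
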